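import Mathlib
import Summits.NavierStokesRegularity.NavierStokesRegularity.Theorems.QuasipotentialCoercivityTwoDimensionalActionBoundPlanar
import HarnessLib

/-!
# Planar calculus for the 2-D calibration inequality, II: the 2-D cancellation and the pressure
  (tools for item stmt-NavierStokesRegularity-1446, `QuasipotentialCoercivity.TwoDimensionalActionBound`)

Fixed-time integral identities on `ℝ² = EuclideanSpace ℝ (Fin 2)` for a divergence-free field
`v ∈ C²` with Schwartz-type decay and a `C²` scalar `P` (continuing
`QuasipotentialCoercivityTwoDimensionalActionBoundPlanar`):

* `integral_inner_laplacian_convect_self_eq_zero₂` — **the 2-D cancellation**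
  `∫ ⟪Δv, (v·∇)v⟫ = 0` (Green, `∂ᵢ((v·∇)v) = (v·∇)∂ᵢv + Dv(∂ᵢv)`, transport, and
  `tr((Dv)ᵀ(Dv)²) = 0` for the traceless `2 × 2` matrix `Dv`: no vortex stretching in the plane);
* `integral_inner_laplacian_gradient_eq_zero₂` — **the pressure drops out in the plane**:
  `∫ ⟪Δv, ∇P⟫ = 0` whenever `‖Dv‖ ‖∇P‖ ∈ L¹` and `⟪Δv, ∇P⟫ ∈ L¹` (no growth condition on `P`):
  `⟪Δv, ∇P⟫ = div Z` for the `C¹` field `Z = ω (∂₁P e₀ − ∂₀P e₁) ∈ L¹` (`Δv = ∇⊥ω`, symmetry of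
  `D²P`), and the whole-plane divergence theorem in `L¹` form
  (`integral_divergence_eq_zero_of_integrable`);
* small helpers (`‖∇P‖ = ‖DP‖`, `L²` bookkeeping, a completed square) for the main file.

HONEST FRAMING: elementary vector calculus for a 2-D calibration inequality about forced
classical paths; nothing here bears on Navier–Stokes regularity.

## References
* A. J. Majda, A. L. Bertozzi, *Vorticity and Incompressible Flow*, CUP (2002), §1.8, §3.1.1.
-/

noncomputable section

set_option linter.dupNamespace false

namespace Summit.NavierStokesRegularity.NavierStokesRegularity.Theorems

open Set MeasureTheory Filter Topology Function InnerProductSpace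
open scoped ENNReal NNReal RealInnerProductSpace ContDiff Laplacian
open Literature.Analysis.FluidPDE

namespace TwoDimActionBound

/-- **The 2-D cancellation `∫ ⟪Δv, (v·∇)v⟫ = 0`** for a divergence-free planar field `v ∈ C²`
decaying with its first two derivatives like `(1 + ‖x‖)^{-r}`, `r > 3`: Green's identity gives
`−Σᵢ ∫ ⟪∂ᵢv, ∂ᵢ((v·∇)v)⟫` with `∂ᵢ((v·∇)v) = (v·∇)∂ᵢv + Dv(∂ᵢv)`; the transport terms
`∫ ⟪(v·∇)∂ᵢv, ∂ᵢv⟫` vanish (`div v = 0`) and `Σᵢ ⟪∂ᵢv, Dv(∂ᵢv)⟫ = tr((Dv)ᵀ(Dv)²) = 0` pointwise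
for the traceless `2 × 2` matrix `Dv` — the vortex-stretching term is absent in the plane
(Majda–Bertozzi §1.8). [folklore] -/
theorem integral_inner_laplacian_convect_self_eq_zero₂ {v : (EuclideanSpace ℝ (Fin 2)) → (EuclideanSpace ℝ (Fin 2))} (hv : ContDiff ℝ 2 v)
    (hdiv : VectorCalculus.IsDivFree v) {C r : ℝ} (hC : 0 ≤ C) (hr : 3 < r)
    (h0 : ∀ x, ‖v x‖ ≤ C * (1 + ‖x‖) ^ (-r)) (h1 : ∀ x, ‖fderiv ℝ v x‖ ≤ C * (1 + ‖x‖) ^ (-r))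
    (h2 : ∀ x, ‖fderiv ℝ (fderiv ℝ v) x‖ ≤ C * (1 + ‖x‖) ^ (-r)) :
    ∫ x, ⟪(Δ v) x, convect v v x⟫ = 0 := by
  have hr2 : (2 : ℝ) < r := by linarith
  have hr0 : 0 ≤ r := by linarith
  have hv1 : ContDiff ℝ 1 v := hv.of_le (by norm_num)
  have hD1 : ContDiff ℝ 1 (fderiv ℝ v) := hv.fderiv_right (m := 1) (by norm_num)
  have hdd : ∀ x, DifferentiableAt ℝ (fderiv ℝ v) x := fun x => (hD1.differentiable one_ne_zero) x
  have cv : Continuous v := hv.continuous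
  have cDv : Continuous (fderiv ℝ v) := hv.continuous_fderiv (by norm_num)
  have cD2 : Continuous (fderiv ℝ (fderiv ℝ v)) := hD1.continuous_fderiv one_ne_zero
  set w : (EuclideanSpace ℝ (Fin 2)) → (EuclideanSpace ℝ (Fin 2)) := convect v v with hwdef
  have hw : ContDiff ℝ 1 w := (hv.fderiv_right (m := 1) (by norm_num)).clm_apply hv1
  have cw : Continuous w := hw.continuous
  -- the slices `∂ᵢ v`
  set vs : Fin 2 → (EuclideanSpace ℝ (Fin 2)) → (EuclideanSpace ℝ (Fin 2)) := fun i y => fderiv ℝ v y (EuclideanSpace.basisFun (Fin 2) ℝ i) with hvs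
  have hvs1 : ∀ i, ContDiff ℝ 1 (vs i) := fun i =>
    (hv.fderiv_right (m := 1) (by norm_num)).clm_apply contDiff_const
  have he1 : ∀ i, ‖(EuclideanSpace.basisFun (Fin 2) ℝ i : (EuclideanSpace ℝ (Fin 2)))‖ = 1 := fun i => (EuclideanSpace.basisFun (Fin 2) ℝ).orthonormal.1 i
  have hle1 : ∀ x : (EuclideanSpace ℝ (Fin 2)), (1 + ‖x‖) ^ (-r) ≤ (1 : ℝ) := fun x => rpow_neg_le_one x hr0
  -- pointwise bounds
  have bvs : ∀ i x, ‖vs i x‖ ≤ C * (1 + ‖x‖) ^ (-r) := fun i x =>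
    (((fderiv ℝ v x).le_opNorm _).trans (by rw [he1, mul_one])).trans (h1 x)
  have hDvs : ∀ i x, fderiv ℝ (vs i) x = (fderiv ℝ (fderiv ℝ v) x).flip (EuclideanSpace.basisFun (Fin 2) ℝ i) := fun i x => by
    ext h
    rw [ContinuousLinearMap.flip_apply, hvs, fderiv_apply_const_apply₂ (hdd x)]
  have bDvs : ∀ i x, ‖fderiv ℝ (vs i) x‖ ≤ C * (1 + ‖x‖) ^ (-r) := fun i x => by
    rw [hDvs]
    calc ‖(fderiv ℝ (fderiv ℝ v) x).flip (EuclideanSpace.basisFun (Fin 2) ℝ i)‖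
        ≤ ‖(fderiv ℝ (fderiv ℝ v) x).flip‖ * ‖(EuclideanSpace.basisFun (Fin 2) ℝ i : (EuclideanSpace ℝ (Fin 2)))‖ :=
          (fderiv ℝ (fderiv ℝ v) x).flip.le_opNorm _
      _ = ‖fderiv ℝ (fderiv ℝ v) x‖ := by rw [ContinuousLinearMap.opNorm_flip, he1, mul_one]
      _ ≤ C * (1 + ‖x‖) ^ (-r) := h2 x
  have bw : ∀ x, ‖w x‖ ≤ C * C * (1 + ‖x‖) ^ (-r) := fun x => by
    calc ‖w x‖ ≤ ‖fderiv ℝ v x‖ * ‖v x‖ := (fderiv ℝ v x).le_opNorm _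
      _ ≤ (C * (1 + ‖x‖) ^ (-r)) * (C * (1 + ‖x‖) ^ (-r)) :=
          mul_le_mul (h1 x) (h0 x) (norm_nonneg _) ((norm_nonneg _).trans (h1 x))
      _ ≤ (C * 1) * (C * (1 + ‖x‖) ^ (-r)) := by gcongr; exact hle1 x
      _ = C * C * (1 + ‖x‖) ^ (-r) := by ring
  have hDw : ∀ x i, fderiv ℝ w x (EuclideanSpace.basisFun (Fin 2) ℝ i) = convect v (vs i) x + fderiv ℝ v x (vs i x) :=
    fun x i => fderiv_convect_self_apply₂ hv x (EuclideanSpace.basisFun (Fin 2) ℝ i)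
  have bDw : ∀ x i, ‖fderiv ℝ w x (EuclideanSpace.basisFun (Fin 2) ℝ i)‖ ≤ 2 * C * C * (1 + ‖x‖) ^ (-r) := fun x i => by
    rw [hDw]
    have ha : ‖convect v (vs i) x‖ ≤ C * C * (1 + ‖x‖) ^ (-r) := by
      calc ‖convect v (vs i) x‖ ≤ ‖fderiv ℝ (vs i) x‖ * ‖v x‖ := (fderiv ℝ (vs i) x).le_opNorm _
        _ ≤ (C * (1 + ‖x‖) ^ (-r)) * (C * (1 + ‖x‖) ^ (-r)) :=
            mul_le_mul (bDvs i x) (h0 x) (norm_nonneg _) ((norm_nonneg _).trans (h1 x))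
        _ ≤ (C * 1) * (C * (1 + ‖x‖) ^ (-r)) := by gcongr; exact hle1 x
        _ = C * C * (1 + ‖x‖) ^ (-r) := by ring
    have hb : ‖fderiv ℝ v x (vs i x)‖ ≤ C * C * (1 + ‖x‖) ^ (-r) := by
      calc ‖fderiv ℝ v x (vs i x)‖ ≤ ‖fderiv ℝ v x‖ * ‖vs i x‖ := (fderiv ℝ v x).le_opNorm _
        _ ≤ (C * (1 + ‖x‖) ^ (-r)) * (C * (1 + ‖x‖) ^ (-r)) :=
            mul_le_mul (h1 x) (bvs i x) (norm_nonneg _) ((norm_nonneg _).trans (h1 x))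
        _ ≤ (C * 1) * (C * (1 + ‖x‖) ^ (-r)) := by gcongr; exact hle1 x
        _ = C * C * (1 + ‖x‖) ^ (-r) := by ring
    calc ‖convect v (vs i) x + fderiv ℝ v x (vs i x)‖
        ≤ ‖convect v (vs i) x‖ + ‖fderiv ℝ v x (vs i x)‖ := norm_add_le _ _
      _ ≤ C * C * (1 + ‖x‖) ^ (-r) + C * C * (1 + ‖x‖) ^ (-r) := add_le_add ha hb
      _ = 2 * C * C * (1 + ‖x‖) ^ (-r) := by ring
  -- integrability of the three Green products
  have I1 : ∀ i, Integrable (fun x => ⟪fderiv ℝ (fun y => fderiv ℝ v y (EuclideanSpace.basisFun (Fin 2) ℝ i)) x (EuclideanSpace.basisFun (Fin 2) ℝ i), w x⟫)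
      volume := fun i => by
    refine integrable_of_le_decay₂ (C := C * (C * C)) ?_ hr2 fun x => ?_
    · exact (((hvs1 i).continuous_fderiv one_ne_zero).clm_apply continuous_const).inner cw
    · calc ‖⟪fderiv ℝ (fun y => fderiv ℝ v y (EuclideanSpace.basisFun (Fin 2) ℝ i)) x (EuclideanSpace.basisFun (Fin 2) ℝ i), w x⟫‖
          ≤ ‖fderiv ℝ (fun y => fderiv ℝ v y (EuclideanSpace.basisFun (Fin 2) ℝ i)) x (EuclideanSpace.basisFun (Fin 2) ℝ i)‖ * ‖w x‖ := norm_inner_le_norm _ _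
        _ ≤ (C * (1 + ‖x‖) ^ (-r)) * (C * C * (1 + ‖x‖) ^ (-r)) := by
            refine mul_le_mul ?_ (bw x) (norm_nonneg _) ((norm_nonneg _).trans (bvs i x))
            exact (((fderiv ℝ (vs i) x).le_opNorm _).trans (by rw [he1, mul_one])).trans (bDvs i x)
        _ ≤ (C * (1 + ‖x‖) ^ (-r)) * (C * C * 1) := by gcongr; exact hle1 x
        _ = C * (C * C) * (1 + ‖x‖) ^ (-r) := by ring
  have I2 : ∀ i, Integrable (fun x => ⟪fderiv ℝ v x (EuclideanSpace.basisFun (Fin 2) ℝ i), fderiv ℝ w x (EuclideanSpace.basisFun (Fin 2) ℝ i)⟫) volume := by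
    intro i
    refine integrable_of_le_decay₂ (C := C * (2 * C * C)) ?_ hr2 fun x => ?_
    · exact (cDv.clm_apply continuous_const).inner
        ((hw.continuous_fderiv one_ne_zero).clm_apply continuous_const)
    · calc ‖⟪fderiv ℝ v x (EuclideanSpace.basisFun (Fin 2) ℝ i), fderiv ℝ w x (EuclideanSpace.basisFun (Fin 2) ℝ i)⟫‖
          ≤ ‖fderiv ℝ v x (EuclideanSpace.basisFun (Fin 2) ℝ i)‖ * ‖fderiv ℝ w x (EuclideanSpace.basisFun (Fin 2) ℝ i)‖ := norm_inner_le_norm _ _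
        _ ≤ (C * (1 + ‖x‖) ^ (-r)) * (2 * C * C * (1 + ‖x‖) ^ (-r)) :=
            mul_le_mul (bvs i x) (bDw x i) (norm_nonneg _) ((norm_nonneg _).trans (bvs i x))
        _ ≤ (C * (1 + ‖x‖) ^ (-r)) * (2 * C * C * 1) := by gcongr; exact hle1 x
        _ = C * (2 * C * C) * (1 + ‖x‖) ^ (-r) := by ring
  have I3 : ∀ i, Integrable (fun x => ⟪fderiv ℝ v x (EuclideanSpace.basisFun (Fin 2) ℝ i), w x⟫) volume := by
    intro i
    refine integrable_of_le_decay₂ (C := C * (C * C)) ?_ hr2 fun x => ?_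
    · exact (cDv.clm_apply continuous_const).inner cw
    · calc ‖⟪fderiv ℝ v x (EuclideanSpace.basisFun (Fin 2) ℝ i), w x⟫‖ ≤ ‖fderiv ℝ v x (EuclideanSpace.basisFun (Fin 2) ℝ i)‖ * ‖w x‖ := norm_inner_le_norm _ _
        _ ≤ (C * (1 + ‖x‖) ^ (-r)) * (C * C * (1 + ‖x‖) ^ (-r)) :=
            mul_le_mul (bvs i x) (bw x) (norm_nonneg _) ((norm_nonneg _).trans (bvs i x))
        _ ≤ (C * (1 + ‖x‖) ^ (-r)) * (C * C * 1) := by gcongr; exact hle1 x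
        _ = C * (C * C) * (1 + ‖x‖) ^ (-r) := by ring
  -- Green
  have hG := green_sum_inner_fderiv₂ hv hw I1 I2 I3
  -- the transport terms vanish
  have hr3 : (Module.finrank ℝ (EuclideanSpace ℝ (Fin 2)) : ℝ) + 1 < r := by
    simpa [finrank_euclideanSpace_fin] using (by linarith : (2 : ℝ) + 1 < r)
  have hT : ∀ i, ∫ x, ⟪convect v (vs i) x, vs i x⟫ = 0 := fun i =>
    integral_inner_fderiv_apply_self_eq_zero (v := v) (w := vs i) hv1 (hvs1 i) hdiv hC hr3
      h0 h1 (bvs i) (bDvs i)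
  -- the stretching term vanishes pointwise
  have hS : ∀ x, ∑ i, ⟪vs i x, fderiv ℝ v x (vs i x)⟫ = 0 := fun x => by
    have htr : fderiv ℝ v x (EuclideanSpace.basisFun (Fin 2) ℝ 0) 0 + fderiv ℝ v x (EuclideanSpace.basisFun (Fin 2) ℝ 1) 1 = 0 := by
      rw [← divergence_eq_two₂]; exact hdiv x
    exact sum_inner_apply_sq_eq_zero₂ (fderiv ℝ v x) htr
  -- assemble
  have hsum : ∫ x, ∑ i, ⟪fderiv ℝ v x (EuclideanSpace.basisFun (Fin 2) ℝ i), fderiv ℝ w x (EuclideanSpace.basisFun (Fin 2) ℝ i)⟫ = 0 := by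
    have hpt : ∀ x, ∑ i, ⟪fderiv ℝ v x (EuclideanSpace.basisFun (Fin 2) ℝ i), fderiv ℝ w x (EuclideanSpace.basisFun (Fin 2) ℝ i)⟫ =
        ∑ i, ⟪convect v (vs i) x, vs i x⟫ := fun x => by
      have := hS x
      simp only [hDw, inner_add_right] at this ⊢
      rw [Finset.sum_add_distrib, this, add_zero]
      exact Finset.sum_congr rfl fun i _ => real_inner_comm _ _
    have hTi : ∀ i, Integrable (fun x => ⟪convect v (vs i) x, vs i x⟫) volume := by
      intro i
      refine integrable_of_le_decay₂ (C := C * C * C) ?_ hr2 fun x => ?_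
      · exact (((hvs1 i).continuous_fderiv one_ne_zero).clm_apply cv).inner (hvs1 i).continuous
      · calc ‖⟪convect v (vs i) x, vs i x⟫‖ ≤ ‖convect v (vs i) x‖ * ‖vs i x‖ :=
              norm_inner_le_norm _ _
          _ ≤ (‖fderiv ℝ (vs i) x‖ * ‖v x‖) * ‖vs i x‖ := by
              gcongr; exact (fderiv ℝ (vs i) x).le_opNorm _
          _ ≤ ((C * (1 + ‖x‖) ^ (-r)) * (C * (1 + ‖x‖) ^ (-r))) * (C * (1 + ‖x‖) ^ (-r)) := by
              refine mul_le_mul (mul_le_mul (bDvs i x) (h0 x) (norm_nonneg _)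
                ((norm_nonneg _).trans (h1 x))) (bvs i x) (norm_nonneg _) ?_
              exact mul_nonneg ((norm_nonneg _).trans (h1 x)) ((norm_nonneg _).trans (h1 x))
          _ ≤ ((C * 1) * (C * 1)) * (C * (1 + ‖x‖) ^ (-r)) := by gcongr <;> exact hle1 x
          _ = C * C * C * (1 + ‖x‖) ^ (-r) := by ring
    rw [integral_congr_ae (Eventually.of_forall hpt), integral_finsetSum _ fun i _ => hTi i]
    exact Finset.sum_eq_zero fun i _ => hT i
  linarith

/-- `|curl2 v (x)| ≤ ‖curl2CLM‖ ‖Dv(x)‖`. [folklore] -/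
theorem abs_curl2_le₂ (v : (EuclideanSpace ℝ (Fin 2)) → (EuclideanSpace ℝ (Fin 2))) (x : (EuclideanSpace ℝ (Fin 2))) : |curl2 v x| ≤ ‖curl2CLM‖ * ‖fderiv ℝ v x‖ := by
  rw [curl2_eq_comp, Function.comp_apply, ← Real.norm_eq_abs]
  exact curl2CLM.le_opNorm _

/-- Partial derivatives are the coordinates of the gradient: `(∇P(x))ᵢ = DP(x) eᵢ`. [folklore] -/
theorem gradient_apply₂ (P : (EuclideanSpace ℝ (Fin 2)) → ℝ) (x : (EuclideanSpace ℝ (Fin 2))) (i : Fin 2) :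
    gradient P x i = fderiv ℝ P x (EuclideanSpace.basisFun (Fin 2) ℝ i) := by
  rw [← inner_basisFun_right₂, gradient, InnerProductSpace.toDual_symm_apply]

/-- **The pressure drops out in the plane.** For a divergence-free planar `v ∈ C²` and a scalar
`P ∈ C²` with `‖Dv‖ ‖DP‖ ∈ L¹` and `⟪Δv, ∇P⟫ ∈ L¹`: `∫ ⟪Δv, ∇P⟫ = 0` — no growth condition on `P`
itself. Indeed `⟪Δv, ∇P⟫ = ∂₀ω ∂₁P − ∂₁ω ∂₀P = div Z` for the `C¹` field
`Z = ω (∂₁P e₀ − ∂₀P e₁) ∈ L¹` (`Δv = ∇⊥ω`, symmetry of `D²P`), and `∫ div Z = 0` by the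
whole-plane divergence theorem in `L¹` form. [folklore] -/
theorem integral_inner_laplacian_gradient_eq_zero₂ {v : (EuclideanSpace ℝ (Fin 2)) → (EuclideanSpace ℝ (Fin 2))} (hv : ContDiff ℝ 2 v)
    (hdiv : VectorCalculus.IsDivFree v) {P : (EuclideanSpace ℝ (Fin 2)) → ℝ} (hP : ContDiff ℝ 2 P)
    (hZ : Integrable (fun x => ‖fderiv ℝ v x‖ * ‖fderiv ℝ P x‖) volume)
    (hI : Integrable (fun x => ⟪(Δ v) x, gradient P x⟫) volume) :
    ∫ x, ⟪(Δ v) x, gradient P x⟫ = 0 := by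
  -- notation
  set om : (EuclideanSpace ℝ (Fin 2)) → ℝ := curl2 v with hom
  set Pd : Fin 2 → (EuclideanSpace ℝ (Fin 2)) → ℝ := fun i y => fderiv ℝ P y (EuclideanSpace.basisFun (Fin 2) ℝ i) with hPd
  have hom1 : ContDiff ℝ 1 om := contDiff_one_curl2₂ hv
  have hP1 : ContDiff ℝ 1 (fderiv ℝ P) := hP.fderiv_right (m := 1) (by norm_num)
  have hPd1 : ∀ i, ContDiff ℝ 1 (Pd i) := fun i => hP1.clm_apply contDiff_const
  have hdom : ∀ x, DifferentiableAt ℝ om x := fun x => (hom1.differentiable one_ne_zero) x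
  have hdPd : ∀ i x, DifferentiableAt ℝ (Pd i) x := fun i x =>
    ((hPd1 i).differentiable one_ne_zero) x
  have hdP2 : ∀ x, DifferentiableAt ℝ (fderiv ℝ P) x := fun x => (hP1.differentiable one_ne_zero) x
  have hsymmP : ∀ x, IsSymmSndFDerivAt ℝ P x := fun x => hP.contDiffAt.isSymmSndFDerivAt (by simp)
  -- the field `Z`
  set Z : (EuclideanSpace ℝ (Fin 2)) → (EuclideanSpace ℝ (Fin 2)) := fun y => (om y * Pd 1 y) • EuclideanSpace.basisFun (Fin 2) ℝ 0 - (om y * Pd 0 y) • EuclideanSpace.basisFun (Fin 2) ℝ 1 with hZdef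
  have hZa : ContDiff ℝ 1 (fun y => om y * Pd 1 y) := hom1.mul (hPd1 1)
  have hZb : ContDiff ℝ 1 (fun y => om y * Pd 0 y) := hom1.mul (hPd1 0)
  have hZ1 : ContDiff ℝ 1 Z := (hZa.smul contDiff_const).sub (hZb.smul contDiff_const)
  -- its derivative
  have hDZ : ∀ x h, fderiv ℝ Z x h =
      (fderiv ℝ om x h * Pd 1 x + om x * fderiv ℝ (fderiv ℝ P) x h (EuclideanSpace.basisFun (Fin 2) ℝ 1)) • EuclideanSpace.basisFun (Fin 2) ℝ 0 -
        (fderiv ℝ om x h * Pd 0 x + om x * fderiv ℝ (fderiv ℝ P) x h (EuclideanSpace.basisFun (Fin 2) ℝ 0)) • EuclideanSpace.basisFun (Fin 2) ℝ 1 := by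
    intro x h
    have ha : HasFDerivAt (fun y => om y * Pd 1 y)
        (om x • fderiv ℝ (Pd 1) x + Pd 1 x • fderiv ℝ om x) x :=
      (hdom x).hasFDerivAt.mul (hdPd 1 x).hasFDerivAt
    have hb : HasFDerivAt (fun y => om y * Pd 0 y)
        (om x • fderiv ℝ (Pd 0) x + Pd 0 x • fderiv ℝ om x) x :=
      (hdom x).hasFDerivAt.mul (hdPd 0 x).hasFDerivAt
    have hZ' : HasFDerivAt Z _ x := (ha.smul_const (EuclideanSpace.basisFun (Fin 2) ℝ 0)).sub (hb.smul_const (EuclideanSpace.basisFun (Fin 2) ℝ 1))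
    rw [hZ'.fderiv]
    simp only [FunLike.coe_sub, Pi.sub_apply, ContinuousLinearMap.smulRight_apply,
      _root_.add_apply, FunLike.coe_smul, Pi.smul_apply, smul_eq_mul, hPd,
      fderiv_apply_const_apply₂ (hdP2 x)]
    congr 2 <;> ring
  -- its divergence is `⟪Δv, ∇P⟫`
  have hdivZ : ∀ x, VectorCalculus.divergence Z x = ⟪(Δ v) x, gradient P x⟫ := by
    intro x
    rw [divergence_eq_two₂, hDZ, hDZ, inner_laplacian_eq_curl2₂ hv hdiv, gradient_apply₂,
      gradient_apply₂]
    have hs : fderiv ℝ (fderiv ℝ P) x (EuclideanSpace.basisFun (Fin 2) ℝ 0) (EuclideanSpace.basisFun (Fin 2) ℝ 1) = fderiv ℝ (fderiv ℝ P) x (EuclideanSpace.basisFun (Fin 2) ℝ 1) (EuclideanSpace.basisFun (Fin 2) ℝ 0) :=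
      hsymmP x (EuclideanSpace.basisFun (Fin 2) ℝ 0) (EuclideanSpace.basisFun (Fin 2) ℝ 1)
    simp only [PiLp.sub_apply, PiLp.smul_apply, smul_eq_mul, basisFun_apply_same₂,
      basisFun_zero_one₂, basisFun_one_zero₂, hPd, hom, mul_one, mul_zero, sub_zero, zero_sub]
    rw [hs]
    ring
  -- `Z ∈ L¹`
  have cZ : Continuous Z := hZ1.continuous
  have hZint : Integrable Z volume := by
    refine Integrable.mono' (hZ.const_mul (2 * ‖curl2CLM‖)) cZ.aestronglyMeasurable
      (Eventually.of_forall fun x => ?_)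
    have he1 : ∀ i, ‖(EuclideanSpace.basisFun (Fin 2) ℝ i : (EuclideanSpace ℝ (Fin 2)))‖ = 1 := fun i => (EuclideanSpace.basisFun (Fin 2) ℝ).orthonormal.1 i
    have hPi : ∀ i, |Pd i x| ≤ ‖fderiv ℝ P x‖ := fun i => by
      rw [← Real.norm_eq_abs]
      exact ((fderiv ℝ P x).le_opNorm _).trans (by rw [he1, mul_one])
    have homx := abs_curl2_le₂ v x
    calc ‖Z x‖ ≤ ‖(om x * Pd 1 x) • EuclideanSpace.basisFun (Fin 2) ℝ 0‖ + ‖(om x * Pd 0 x) • EuclideanSpace.basisFun (Fin 2) ℝ 1‖ :=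
          norm_sub_le _ _
      _ = |om x| * |Pd 1 x| + |om x| * |Pd 0 x| := by
          rw [norm_smul, norm_smul, he1, he1, mul_one, mul_one, Real.norm_eq_abs,
            Real.norm_eq_abs, abs_mul, abs_mul]
      _ ≤ (‖curl2CLM‖ * ‖fderiv ℝ v x‖) * ‖fderiv ℝ P x‖ +
            (‖curl2CLM‖ * ‖fderiv ℝ v x‖) * ‖fderiv ℝ P x‖ := by
          gcongr <;> first | exact homx | exact hPi _
      _ = 2 * ‖curl2CLM‖ * (‖fderiv ℝ v x‖ * ‖fderiv ℝ P x‖) := by ring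
  have hdivint : Integrable (fun x => VectorCalculus.divergence Z x) volume := by
    refine hI.congr (Eventually.of_forall fun x => ?_)
    exact (hdivZ x).symm
  have h0 := integral_divergence_eq_zero_of_integrable hZ1 hZint hdivint
  rw [← h0]
  exact integral_congr_ae (Eventually.of_forall fun x => (hdivZ x).symm)

/-! ### Small helpers for the production bound -/

/-- `‖∇P(x)‖ = ‖DP(x)‖` (the Riesz isometry). [folklore] -/
theorem norm_gradient_eq₂ (P : (EuclideanSpace ℝ (Fin 2)) → ℝ) (x : (EuclideanSpace ℝ (Fin 2))) : ‖gradient P x‖ = ‖fderiv ℝ P x‖ := by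
  rw [gradient]
  exact (InnerProductSpace.toDual ℝ (EuclideanSpace ℝ (Fin 2))).symm.norm_map _

/-- A continuous field with `∫⁻ ‖f‖ₑ² < ∞` has integrable `‖f‖²`. [folklore] -/
theorem integrable_sq_of_lintegral_lt_top₂ {f : (EuclideanSpace ℝ (Fin 2)) → (EuclideanSpace ℝ (Fin 2))} (hf : Continuous f)
    (h : ∫⁻ x, ‖f x‖ₑ ^ 2 < ⊤) : Integrable (fun x => ‖f x‖ ^ 2) volume := by
  refine ⟨(hf.norm.pow 2).aestronglyMeasurable, ?_⟩
  refine (hasFiniteIntegral_iff_enorm).2 (lt_of_le_of_lt (le_of_eq ?_) h)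
  refine lintegral_congr fun x => ?_
  rw [Real.enorm_eq_ofReal (sq_nonneg _), ← ofReal_norm, ENNReal.ofReal_pow (norm_nonneg _)]

/-- Completing the square: `4ν (−ν ‖A‖² − ⟪A, F⟫) ≤ ‖F‖²` (`= ‖F‖² − ‖2νA + F‖² + …`). [folklore] -/
theorem four_mul_production_le (ν : ℝ) (A F : (EuclideanSpace ℝ (Fin 2))) :
    4 * ν * (-(ν * ‖A‖ ^ 2) - ⟪A, F⟫) ≤ ‖F‖ ^ 2 := by
  have h := norm_add_sq_real ((2 * ν) • A) F
  rw [norm_smul, mul_pow, real_inner_smul_left, Real.norm_eq_abs, sq_abs] at h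
  nlinarith [sq_nonneg ‖(2 * ν) • A + F‖, h]

/-- Product of two decaying bounds: `a b ≤ A B (1 + ‖x‖)^{-r}` when `a ≤ A (1 + ‖x‖)^{-r}`,
`b ≤ B (1 + ‖x‖)^{-r}`, `r ≥ 0`. [folklore] -/
theorem mul_le_decay₂ {r : ℝ} (hr : 0 ≤ r) {a b A B : ℝ} (x : (EuclideanSpace ℝ (Fin 2))) (ha : 0 ≤ a) (hb : 0 ≤ b)
    (haA : a ≤ A * (1 + ‖x‖) ^ (-r)) (hbB : b ≤ B * (1 + ‖x‖) ^ (-r)) (hA : 0 ≤ A) :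
    a * b ≤ A * B * (1 + ‖x‖) ^ (-r) := by
  have hle1 : (1 + ‖x‖) ^ (-r) ≤ (1 : ℝ) := rpow_neg_le_one x hr
  have hw0 : (0 : ℝ) ≤ (1 + ‖x‖) ^ (-r) := Real.rpow_nonneg (by positivity) _
  have hB : 0 ≤ B * (1 + ‖x‖) ^ (-r) := hb.trans hbB
  calc a * b ≤ (A * (1 + ‖x‖) ^ (-r)) * (B * (1 + ‖x‖) ^ (-r)) := mul_le_mul haA hbB hb (ha.trans haA)
    _ ≤ (A * 1) * (B * (1 + ‖x‖) ^ (-r)) := by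
        refine mul_le_mul_of_nonneg_right ?_ hB
        exact mul_le_mul_of_nonneg_left hle1 hA
    _ = A * B * (1 + ‖x‖) ^ (-r) := by ring

/-- `‖Dv‖ ‖DP‖ ∈ L¹` when `Dv` decays like `C (1 + ‖x‖)^{-r}` (`r > 2`) and
`‖DP‖ ≤ ‖f‖ + K (1 + ‖x‖)^{-r}` with `f ∈ L²`: `‖Dv‖ ‖DP‖ ≤ ½(‖Dv‖² + ‖f‖²) + C K (1 + ‖x‖)^{-r}`. [folklore] -/
theorem integrable_norm_mul_norm_of_bounds₂ {v f : (EuclideanSpace ℝ (Fin 2)) → (EuclideanSpace ℝ (Fin 2))} {P : (EuclideanSpace ℝ (Fin 2)) → ℝ}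
    (cDv : Continuous (fderiv ℝ v)) (cDP : Continuous (fderiv ℝ P))
    (hf2 : Integrable (fun x => ‖f x‖ ^ 2) volume) {C K r : ℝ} (hC : 0 ≤ C) (hK : 0 ≤ K)
    (hr2 : 2 < r) (hr0 : 0 ≤ r) (h1 : ∀ x, ‖fderiv ℝ v x‖ ≤ C * (1 + ‖x‖) ^ (-r))
    (hgP : ∀ x, ‖fderiv ℝ P x‖ ≤ ‖f x‖ + K * (1 + ‖x‖) ^ (-r)) :
    Integrable (fun x => ‖fderiv ℝ v x‖ * ‖fderiv ℝ P x‖) volume := by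
  have hr' : (Module.finrank ℝ (EuclideanSpace ℝ (Fin 2)) : ℝ) < r := by simpa [finrank_euclideanSpace_fin] using hr2
  have iD2 : Integrable (fun x => ‖fderiv ℝ v x‖ ^ 2) volume :=
    integrable_of_le_decay₂ ((cDv.norm).pow 2) hr2 fun x => by
      rw [norm_pow, norm_norm, sq]
      exact mul_le_decay₂ hr0 x (norm_nonneg _) (norm_nonneg _) (h1 x) (h1 x) hC
  have iw : Integrable (fun x : (EuclideanSpace ℝ (Fin 2)) => (1 + ‖x‖) ^ (-r)) volume := integrable_one_add_norm hr'
  have hb : Integrable (fun x => (‖fderiv ℝ v x‖ ^ 2 + ‖f x‖ ^ 2) / 2 + C * K * (1 + ‖x‖) ^ (-r))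
      volume := by
    exact ((iD2.add hf2).div_const 2).add (iw.const_mul (C * K))
  refine hb.mono' (cDv.norm.mul cDP.norm).aestronglyMeasurable (Eventually.of_forall fun x => ?_)
  rw [Real.norm_eq_abs, abs_of_nonneg (by positivity)]
  have hw0 : (0 : ℝ) ≤ (1 + ‖x‖) ^ (-r) := Real.rpow_nonneg (by positivity) _
  have hDv0 : 0 ≤ ‖fderiv ℝ v x‖ := norm_nonneg _
  have e1 : ‖fderiv ℝ v x‖ * ‖f x‖ ≤ (‖fderiv ℝ v x‖ ^ 2 + ‖f x‖ ^ 2) / 2 := by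
    nlinarith [sq_nonneg (‖fderiv ℝ v x‖ - ‖f x‖)]
  have e2 : ‖fderiv ℝ v x‖ * (K * (1 + ‖x‖) ^ (-r)) ≤ C * K * (1 + ‖x‖) ^ (-r) := by
    have := mul_le_decay₂ hr0 x hDv0 (mul_nonneg hK hw0) (h1 x) le_rfl hC
    linarith
  calc ‖fderiv ℝ v x‖ * ‖fderiv ℝ P x‖
      ≤ ‖fderiv ℝ v x‖ * (‖f x‖ + K * (1 + ‖x‖) ^ (-r)) := mul_le_mul_of_nonneg_left (hgP x) hDv0
    _ = ‖fderiv ℝ v x‖ * ‖f x‖ + ‖fderiv ℝ v x‖ * (K * (1 + ‖x‖) ^ (-r)) := by ring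
    _ ≤ (‖fderiv ℝ v x‖ ^ 2 + ‖f x‖ ^ 2) / 2 + C * K * (1 + ‖x‖) ^ (-r) := add_le_add e1 e2

end TwoDimActionBound

end Summit.NavierStokesRegularity.NavierStokesRegularity.Theorems
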